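import Mathlib
import Summits.ValiantsHypothesis.ValiantsHypothesis.Theorems.NewtonUnitEquationsTwoProductsFormalLogLinearisationDefs
import Summits.ValiantsHypothesis.ValiantsHypothesis.Theorems.NewtonUnitEquationsTwoProductsFormalLogLinearisationTame
import Summits.ValiantsHypothesis.ValiantsHypothesis.Theorems.NewtonUnitEquationsTwoProductsFormalLogLinearisationStubRaysRung

/-!
# Crux `TwoProducts` (stmt-ValiantsHypothesis-5906), line `formal-log-linearisation`: the LIFTED PENCIL COUNT is necessary

The engine `LogSumEngine` of the registered line `Cruxes/TwoProducts/Lines/formal-log-linearisation.lean` (NOT the item's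
skeleton of record) is crux-equivalent in the tree (`twoProducts_of_logSumEngine` p585696, `logSumEngine_of_twoProducts`
p586536).  The theory memo `memo-logSumEngine-core.md` (val-width-0318-p2, evidence n°45 on 5906) isolates its LIFTED form:
for two `m`-point configurations `A, B ⊂ ℂ^s` put `G μ = Σ_j A_j^μ − Σ_j B_j^μ`; a multi-index `μ` is PENCIL-VISIBLE for a
2-pencil of positive gradings `θ₁ + c·θ₂` if `G μ ≠ 0` and `μ` is the strict `(θ₁ + c θ₂)`-minimiser of `{ν : G ν ≠ 0}` for
some `c > 0`; `LiftedPencilCount` says pencil-visible multi-indices number `≤ 2^(a·m)·(s+2)^b`.  The memo sketches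
"engine ⇒ LiftedPencilCount" with a rounding-and-carry construction.  This file proves the necessity for INTEGER pencils
(`θ₁, θ₂ : Fin s → ℕ`, positive) — the form every disprover search uses (weights are integers there), and with NO rounding:

  `liftedPencilCountNat_of_logSumEngine : (LogSumEngine body) → (LiftedPencilCount body with θ₁ θ₂ : Fin s → ℕ)`.

Construction.  Take the planar exponents `e_i := (θ₁ i, θ₂ i) ∈ ℕ² ∖ 0` themselves and the `s`-sparse tails
`u_j := Σ_i A_{ji} X^{e_i}`, `v_j := Σ_i B_{ji} X^{e_i}`.  The multinomial theorem lifts the line's log-coefficients: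
`logDiff u v n = Σ_r Σ_{|k| = r} [π k = n] ((−1)^{r+1}/r)·multinomial(k)·G(k)` with `π k = Σ_i k_i • e_i`
(`logDiff_eq_lifted_sum`).  For the valid weight `ξ = (−1, −c)` one has `wt ξ (π k) = −Σ_i (θ₁ i + c θ₂ i) k_i`, so a
pencil-visible `μ` (i) has a fibre `π⁻¹(π μ)` on which `G` vanishes except at `μ` (another fibre point with `G ≠ 0` would
tie with `μ` in `θ_c`-weight, contradicting STRICT minimality) — hence `logDiff (π μ) = w_μ·G μ ≠ 0`; and (ii) beats every
other point of `logSupport` (each has a fibre point in `{G ≠ 0}`).  So `π` maps the pencil-visible set injectively into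
`logVisible u v`, and the engine bounds it.  (Real pencils reduce to integer ones by rounding — an open condition on the
finitely many competitors below any weight level; not done here.)

Honest framing: a CONDITIONAL transfer on a non-record line (the engine is OPEN; this credits nothing); its value is to make
the integer-pencil `LiftedPencilCount` a tree-certified NECESSARY condition of the engine, hence of the crux `TwoProducts`
(a disprover target: a counterexample refutes the crux).  `TwoProducts` is OPEN; nothing here bears on `VP ≠ VNP`.

The memo's signature, for the strategist (kept as a comment, not a tagged definition):
```
def LiftedPencilCount : Prop :=
  ∃ a b : ℕ, ∀ (m s : ℕ) (A B : Fin m → Fin s → ℂ) (θ₁ θ₂ : Fin s → ℝ),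
    (∀ i, 0 < θ₁ i) → (∀ i, 0 < θ₂ i) →
    ∀ S : Finset (Fin s → ℕ),
      (∀ μ ∈ S, (∑ j, ∏ i, A j i ^ μ i) ≠ (∑ j, ∏ i, B j i ^ μ i) ∧
        ∃ c : ℝ, 0 < c ∧ ∀ ν : Fin s → ℕ, ν ≠ μ →
          (∑ j, ∏ i, A j i ^ ν i) ≠ (∑ j, ∏ i, B j i ^ ν i) →
            ∑ i, (θ₁ i + c * θ₂ i) * (μ i : ℝ) < ∑ i, (θ₁ i + c * θ₂ i) * (ν i : ℝ)) →
      S.card ≤ 2 ^ (a * m) * (s + 2) ^ b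
```
-/

set_option linter.dupNamespace false

noncomputable section

open scoped BigOperators
open MvPolynomial

namespace Summit.ValiantsHypothesis.ValiantsHypothesis.Theorems.NewtonUnitEquations.TwoProducts.FormalLogLinearisation

/-! ## The multinomial lifting of the log-coefficients -/

/-- Coefficients of a power of a sum of monomials (multinomial theorem): `coeff n ((Σ_i a_i X^{e_i})^r) =
Σ_{|k| = r} [Σ k_i e_i = n]·multinomial(k)·∏ a_i^{k_i}`. [folklore] -/
theorem coeff_pow_sum_monomial {s : ℕ} (e : Fin s → Expo) (a : Fin s → ℂ) (r : ℕ) (n : Expo) :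
    coeff n ((∑ i, monomial (e i) (a i)) ^ r) =
      ∑ k ∈ (Finset.univ : Finset (Fin s)).piAntidiag r,
        (if ∑ i, k i • e i = n then (Nat.multinomial Finset.univ k : ℂ) else 0) * ∏ i, a i ^ k i := by
  classical
  rw [Finset.sum_pow_eq_sum_piAntidiag, coeff_sum]
  refine Finset.sum_congr rfl fun k _ => ?_
  have hprod : ∏ i, (monomial (e i) (a i) : MvPolynomial (Fin 2) ℂ) ^ k i =
      monomial (∑ i, k i • e i) (∏ i, a i ^ k i) := by
    simp_rw [monomial_pow]
    exact (monomial_sum_prod _ _ _).symm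
  rw [hprod, ← C_eq_coe_nat, C_mul_monomial, coeff_monomial]
  split_ifs <;> simp

/-- The line's `logDiff` in lifted form: for tails `u_j = Σ_i A_{ji} X^{e_i}`, `v_j = Σ_i B_{ji} X^{e_i}`,
`logDiff u v n = Σ_{r=1}^{n₀+n₁} Σ_{|k| = r} [Σ k_i e_i = n]·((−1)^{r+1}/r)·multinomial(k)·G(k)`,
`G(k) = Σ_j A_j^k − Σ_j B_j^k`. [folklore] -/
theorem logDiff_eq_lifted_sum {m s : ℕ} (e : Fin s → Expo) (A B : Fin m → Fin s → ℂ) (n : Expo) :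
    logDiff (fun j => ∑ i, monomial (e i) (A j i)) (fun j => ∑ i, monomial (e i) (B j i)) n =
      ∑ r ∈ Finset.Icc 1 (n 0 + n 1), ∑ k ∈ (Finset.univ : Finset (Fin s)).piAntidiag r,
        (if ∑ i, k i • e i = n then (-1 : ℂ) ^ (r + 1) / (r : ℂ) * (Nat.multinomial Finset.univ k : ℂ) else 0) *
          ((∑ j, ∏ i, A j i ^ k i) - (∑ j, ∏ i, B j i ^ k i)) := by
  classical
  unfold logDiff logCoeff
  simp only [coeff_pow_sum_monomial, Finset.mul_sum]
  rw [Finset.sum_comm (s := Finset.univ), Finset.sum_comm (s := Finset.univ) (t := Finset.Icc 1 (n 0 + n 1)),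
    ← Finset.sum_sub_distrib]
  refine Finset.sum_congr rfl fun r _ => ?_
  rw [Finset.sum_comm, Finset.sum_comm (s := Finset.univ), ← Finset.sum_sub_distrib]
  refine Finset.sum_congr rfl fun k _ => ?_
  rw [← Finset.mul_sum, ← Finset.mul_sum, ← Finset.mul_sum, ← Finset.mul_sum]
  split_ifs <;> ring

/-! ## Weights of lifted points -/

/-- The planar exponent attached to a pair of pencil coordinates. [folklore] -/
theorem pencilExpo_apply (a b : ℕ) :
    (Finsupp.single (0 : Fin 2) a + Finsupp.single (1 : Fin 2) b : Expo) 0 = a ∧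
      (Finsupp.single (0 : Fin 2) a + Finsupp.single (1 : Fin 2) b : Expo) 1 = b := by
  simp

/-- The weight `(−1, −c)` of a lifted point `Σ_i k_i e_i`, `e_i = (θ₁ i, θ₂ i)`, is `−Σ_i (θ₁ i + c θ₂ i) k_i`.
[folklore] -/
theorem wt_lift {s : ℕ} (θ₁ θ₂ : Fin s → ℕ) (c : ℝ) (k : Fin s → ℕ) :
    wt ![-1, -c] (∑ i, k i • (Finsupp.single (0 : Fin 2) (θ₁ i) + Finsupp.single (1 : Fin 2) (θ₂ i) : Expo)) =
      -∑ i, (((θ₁ i : ℕ) : ℝ) + c * ((θ₂ i : ℕ) : ℝ)) * ((k i : ℕ) : ℝ) := by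
  simp only [wt, Matrix.cons_val_zero, Matrix.cons_val_one, Matrix.cons_val_fin_one, Finsupp.coe_finsetSum,
    Finset.sum_apply, Finsupp.coe_smul, Pi.smul_apply, smul_eq_mul, Finsupp.coe_add, Pi.add_apply,
    Finsupp.single_apply]
  simp only [show ((1 : Fin 2) = 0) = False by decide, show ((0 : Fin 2) = 1) = False by decide, if_true, if_false,
    add_zero, zero_add]
  push_cast
  rw [Finset.mul_sum, Finset.mul_sum, ← Finset.sum_neg_distrib, ← Finset.sum_add_distrib]
  refine Finset.sum_congr rfl fun i _ => ?_
  ring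

/-! ## The necessity transfer -/

/-- **`LogSumEngine ⇒ LiftedPencilCount` (integer pencils).**  If the log-sum engine holds (hypothesis = the line's
`LogSumEngine` / STUB 5 `stub_logSumEngine` VERBATIM; OPEN, NOT claimed), then for every pair of `m`-point configurations
`A, B` in `ℂ^s`, every 2-pencil of POSITIVE INTEGER gradings `θ₁ + c·θ₂` (`c > 0` real) and every finite set `S` of
pencil-visible multi-indices (`G μ ≠ 0` and `μ` the strict `(θ₁ + cθ₂)`-minimiser of `{G ≠ 0}` for some `c > 0`), one has
`#S ≤ 2^(a·m)·(s+2)^b` with the engine's own constants.  [folklore] -/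
theorem liftedPencilCountNat_of_logSumEngine
    (hE : ∃ a b : ℕ, ∀ (m t : ℕ), 2 ≤ t → ∀ (u v : Fin m → MvPolynomial (Fin 2) ℂ),
      (∀ j, coeff 0 (u j) = 0 ∧ (u j).support.card ≤ t) → (∀ j, coeff 0 (v j) = 0 ∧ (v j).support.card ≤ t) →
        ∀ S : Finset Expo, (↑S ⊆ logVisible u v) → S.card ≤ 2 ^ (a * m) * (t + 2) ^ b) :
    ∃ a b : ℕ, ∀ (m s : ℕ) (A B : Fin m → Fin s → ℂ) (θ₁ θ₂ : Fin s → ℕ),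
      (∀ i, 0 < θ₁ i) → (∀ i, 0 < θ₂ i) →
      ∀ S : Finset (Fin s → ℕ),
        (∀ μ ∈ S, (∑ j, ∏ i, A j i ^ μ i) ≠ (∑ j, ∏ i, B j i ^ μ i) ∧
          ∃ c : ℝ, 0 < c ∧ ∀ ν : Fin s → ℕ, ν ≠ μ →
            (∑ j, ∏ i, A j i ^ ν i) ≠ (∑ j, ∏ i, B j i ^ ν i) →
              ∑ i, (((θ₁ i : ℕ) : ℝ) + c * ((θ₂ i : ℕ) : ℝ)) * ((μ i : ℕ) : ℝ) <
                ∑ i, (((θ₁ i : ℕ) : ℝ) + c * ((θ₂ i : ℕ) : ℝ)) * ((ν i : ℕ) : ℝ)) →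
        S.card ≤ 2 ^ (a * m) * (s + 2) ^ b := by
  classical
  obtain ⟨a, b, hE⟩ := hE
  refine ⟨a, b, fun m s A B θ₁ θ₂ hθ₁ hθ₂ S hS => ?_⟩
  have hRHS : 1 ≤ 2 ^ (a * m) * (s + 2) ^ b := Nat.one_le_iff_ne_zero.mpr (by positivity)
  -- abbreviations: G, the planar exponents, the tails, the lift `π`
  set G : (Fin s → ℕ) → ℂ := fun k => (∑ j, ∏ i, A j i ^ k i) - (∑ j, ∏ i, B j i ^ k i) with hG
  have hGne : ∀ k, G k ≠ 0 ↔ (∑ j, ∏ i, A j i ^ k i) ≠ (∑ j, ∏ i, B j i ^ k i) := fun k => sub_ne_zero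
  set e : Fin s → Expo := fun i => Finsupp.single (0 : Fin 2) (θ₁ i) + Finsupp.single (1 : Fin 2) (θ₂ i) with he
  have he0 : ∀ i, (e i) 0 = θ₁ i := fun i => (pencilExpo_apply _ _).1
  have he1 : ∀ i, (e i) 1 = θ₂ i := fun i => (pencilExpo_apply _ _).2
  have hene : ∀ i, e i ≠ 0 := fun i h => by
    have := congrArg (fun x : Expo => x 0) h
    rw [he0] at this
    exact (hθ₁ i).ne' (by simpa using this)
  set π : (Fin s → ℕ) → Expo := fun k => ∑ i, k i • e i with hπ
  set u : Fin m → MvPolynomial (Fin 2) ℂ := fun j => ∑ i, monomial (e i) (A j i) with hu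
  set v : Fin m → MvPolynomial (Fin 2) ℂ := fun j => ∑ i, monomial (e i) (B j i) with hv
  -- the lifted weight identity for the weight `(−1, −c)`
  have hwt : ∀ (c : ℝ) (k : Fin s → ℕ),
      wt ![-1, -c] (π k) = -∑ i, (((θ₁ i : ℕ) : ℝ) + c * ((θ₂ i : ℕ) : ℝ)) * ((k i : ℕ) : ℝ) :=
    fun c k => wt_lift θ₁ θ₂ c k
  -- tails: supports, constant terms, sparsity
  have hsuppu : ∀ j, (u j).support ⊆ Finset.univ.image e := fun j => by
    refine support_sum.trans (Finset.biUnion_subset.mpr fun i _ => ?_)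
    exact support_monomial_subset.trans (Finset.singleton_subset_iff.mpr (Finset.mem_image_of_mem e (Finset.mem_univ i)))
  have hsuppv : ∀ j, (v j).support ⊆ Finset.univ.image e := fun j => by
    refine support_sum.trans (Finset.biUnion_subset.mpr fun i _ => ?_)
    exact support_monomial_subset.trans (Finset.singleton_subset_iff.mpr (Finset.mem_image_of_mem e (Finset.mem_univ i)))
  have hcard_img : (Finset.univ.image e).card ≤ s := Finset.card_image_le.trans (by simp)
  have hu0 : ∀ j, coeff 0 (u j) = 0 := fun j => by
    rw [hu]
    simp only [coeff_sum, coeff_monomial]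
    exact Finset.sum_eq_zero fun i _ => if_neg (hene i)
  have hv0 : ∀ j, coeff 0 (v j) = 0 := fun j => by
    rw [hv]
    simp only [coeff_sum, coeff_monomial]
    exact Finset.sum_eq_zero fun i _ => if_neg (hene i)
  have hut : ∀ j, coeff 0 (u j) = 0 ∧ (u j).support.card ≤ s :=
    fun j => ⟨hu0 j, (Finset.card_le_card (hsuppu j)).trans hcard_img⟩
  have hvt : ∀ j, coeff 0 (v j) = 0 ∧ (v j).support.card ≤ s :=
    fun j => ⟨hv0 j, (Finset.card_le_card (hsuppv j)).trans hcard_img⟩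
  -- valid weights
  have hvalid : ∀ c : ℝ, 0 < c → ValidWeight u v ![-1, -c] := by
    intro c hc
    have hneg : ∀ x ∈ Finset.univ.image e, wt ![-1, -c] x < 0 := by
      intro x hx
      obtain ⟨i, -, rfl⟩ := Finset.mem_image.mp hx
      have h1 : (0 : ℝ) < ((θ₁ i : ℕ) : ℝ) := by exact_mod_cast hθ₁ i
      have h2 : (0 : ℝ) < ((θ₂ i : ℕ) : ℝ) := by exact_mod_cast hθ₂ i
      simp only [wt, Matrix.cons_val_zero, Matrix.cons_val_one, Matrix.cons_val_fin_one, he0, he1]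
      nlinarith
    exact ⟨fun j x hx => hneg x (hsuppu j hx), fun j x hx => hneg x (hsuppv j hx)⟩
  -- the lifted formula for `logDiff u v`
  have hlift : ∀ n : Expo, logDiff u v n =
      ∑ r ∈ Finset.Icc 1 (n 0 + n 1), ∑ k ∈ (Finset.univ : Finset (Fin s)).piAntidiag r,
        (if π k = n then (-1 : ℂ) ^ (r + 1) / (r : ℂ) * (Nat.multinomial Finset.univ k : ℂ) else 0) * G k :=
    fun n => logDiff_eq_lifted_sum e A B n
  -- (b') every point of `logSupport u v` has a fibre point with `G ≠ 0`
  have hfibre : ∀ n : Expo, n ∈ logSupport u v → ∃ k : Fin s → ℕ, π k = n ∧ G k ≠ 0 := by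
    intro n hn
    have hn' : logDiff u v n ≠ 0 := hn
    rw [hlift n] at hn'
    obtain ⟨r, -, hr⟩ := Finset.exists_ne_zero_of_sum_ne_zero hn'
    obtain ⟨k, -, hk⟩ := Finset.exists_ne_zero_of_sum_ne_zero hr
    by_cases hπk : π k = n
    · exact ⟨k, hπk, fun h0 => hk (by rw [h0, mul_zero])⟩
    · exact absurd (by rw [if_neg hπk, zero_mul]) hk
  -- total degree of a lifted point dominates `|k|`
  have hdeg : ∀ k : Fin s → ℕ, ∑ i, k i ≤ (π k) 0 + (π k) 1 := by
    intro k
    have h0 : (π k) 0 = ∑ i, k i * θ₁ i := by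
      simp only [hπ, Finsupp.coe_finsetSum, Finset.sum_apply, Finsupp.coe_smul, Pi.smul_apply, smul_eq_mul, he0]
    have h1 : (π k) 1 = ∑ i, k i * θ₂ i := by
      simp only [hπ, Finsupp.coe_finsetSum, Finset.sum_apply, Finsupp.coe_smul, Pi.smul_apply, smul_eq_mul, he1]
    rw [h0, h1, ← Finset.sum_add_distrib]
    exact Finset.sum_le_sum fun i _ => by nlinarith [hθ₁ i, hθ₂ i]
  -- (a') for pencil-visible `μ`: `logDiff (π μ) = w_μ · G μ ≠ 0`
  have hvis : ∀ μ : Fin s → ℕ, ∀ c : ℝ, G μ ≠ 0 →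
      (∀ ν : Fin s → ℕ, ν ≠ μ → G ν ≠ 0 →
        ∑ i, (((θ₁ i : ℕ) : ℝ) + c * ((θ₂ i : ℕ) : ℝ)) * ((μ i : ℕ) : ℝ) <
          ∑ i, (((θ₁ i : ℕ) : ℝ) + c * ((θ₂ i : ℕ) : ℝ)) * ((ν i : ℕ) : ℝ)) →
      logDiff u v (π μ) ≠ 0 := by
    intro μ c hGμ hmin
    -- fibre points other than `μ` have `G = 0`
    have hfib : ∀ k : Fin s → ℕ, π k = π μ → k ≠ μ → G k = 0 := by
      intro k hk hne
      by_contra hGk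
      have hlt := hmin k hne hGk
      have hw := congrArg (wt ![-1, -c]) hk
      rw [hwt, hwt] at hw
      linarith
    have hμ0 : 1 ≤ ∑ i, μ i := by
      by_contra h
      push Not at h
      have hz : ∀ i, μ i = 0 := fun i => by
        have := Finset.single_le_sum (f := μ) (fun i _ => Nat.zero_le _) (Finset.mem_univ i)
        omega
      apply hGμ
      simp [hG, hz]
    rw [hlift (π μ)]
    rw [Finset.sum_eq_single (∑ i, μ i)]
    · rw [Finset.sum_eq_single μ]
      · rw [if_pos rfl]
        refine mul_ne_zero (mul_ne_zero (div_ne_zero (pow_ne_zero _ (by norm_num)) ?_) ?_) hGμ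
        · exact_mod_cast (show (∑ i, μ i) ≠ 0 by omega)
        · exact_mod_cast (Nat.multinomial_pos Finset.univ μ).ne'
      · intro k hk hne
        by_cases hπk : π k = π μ
        · rw [hfib k hπk hne, mul_zero]
        · rw [if_neg hπk, zero_mul]
      · intro hμ
        exact absurd (Finset.mem_piAntidiag.mpr ⟨by simp, fun i _ => Finset.mem_univ i⟩) hμ
    · intro r _ hr
      refine Finset.sum_eq_zero fun k hk => ?_
      have hkr : ∑ i, k i = r := by simpa using (Finset.mem_piAntidiag.mp hk).1
      have hne : k ≠ μ := fun h => hr (by rw [← hkr, h])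
      by_cases hπk : π k = π μ
      · rw [hfib k hπk hne, mul_zero]
      · rw [if_neg hπk, zero_mul]
    · intro h
      exact absurd (Finset.mem_Icc.mpr ⟨hμ0, hdeg μ⟩) h
  -- the pencil-visible set charts injectively into `logVisible u v`
  have hmaps : ∀ μ ∈ S, π μ ∈ logVisible u v := by
    intro μ hμ
    obtain ⟨hGμ', c, hc, hmin'⟩ := hS μ hμ
    have hGμ : G μ ≠ 0 := (hGne μ).mpr hGμ'
    have hmin : ∀ ν : Fin s → ℕ, ν ≠ μ → G ν ≠ 0 →
        ∑ i, (((θ₁ i : ℕ) : ℝ) + c * ((θ₂ i : ℕ) : ℝ)) * ((μ i : ℕ) : ℝ) <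
          ∑ i, (((θ₁ i : ℕ) : ℝ) + c * ((θ₂ i : ℕ) : ℝ)) * ((ν i : ℕ) : ℝ) :=
      fun ν hne hGν => hmin' ν hne ((hGne ν).mp hGν)
    refine ⟨![-1, -c], hvalid c hc, hvis μ c hGμ hmin, fun n hn hne => ?_⟩
    obtain ⟨k, rfl, hGk⟩ := hfibre n hn
    have hkμ : k ≠ μ := fun h => hne (by rw [h])
    have hlt := hmin k hkμ hGk
    rw [hwt, hwt]
    linarith
  have hinj : Set.InjOn π ↑S := by
    intro μ hμ μ' hμ' hππ
    by_contra hne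
    obtain ⟨-, c, -, hmin'⟩ := hS μ hμ
    obtain ⟨hGμ', -, -, -⟩ := hS μ' hμ'
    have hlt := hmin' μ' (Ne.symm hne) hGμ'
    have hw := congrArg (wt ![-1, -c]) hππ
    rw [hwt, hwt] at hw
    linarith
  -- count: `s ≤ 1` by hand, `s ≥ 2` by the engine at `t = s`
  rcases lt_or_ge s 2 with hs | hs
  · -- at most one pencil-visible point: with `s ≤ 1` all indices coincide, so of two distinct multi-indices one is
    -- pointwise below the other and cannot be beaten by it for a positive grading
    have hidx : ∀ i i' : Fin s, i = i' := fun i i' => Fin.ext (by omega)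
    have hcmp : ∀ μ μ' : Fin s → ℕ, (∀ i, μ i ≤ μ' i) ∨ (∀ i, μ' i ≤ μ i) := by
      intro μ μ'
      by_cases h : ∀ i, μ i ≤ μ' i
      · exact Or.inl h
      · push Not at h
        obtain ⟨i₀, hi₀⟩ := h
        exact Or.inr fun i => by rw [hidx i i₀]; exact hi₀.le
    have hmono : ∀ (c : ℝ), 0 < c → ∀ μ μ' : Fin s → ℕ, (∀ i, μ i ≤ μ' i) →
        ∑ i, (((θ₁ i : ℕ) : ℝ) + c * ((θ₂ i : ℕ) : ℝ)) * ((μ i : ℕ) : ℝ) ≤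
          ∑ i, (((θ₁ i : ℕ) : ℝ) + c * ((θ₂ i : ℕ) : ℝ)) * ((μ' i : ℕ) : ℝ) := by
      intro c hc μ μ' hle
      refine Finset.sum_le_sum fun i _ => ?_
      have h1 : (0 : ℝ) ≤ ((θ₁ i : ℕ) : ℝ) + c * ((θ₂ i : ℕ) : ℝ) := by positivity
      have h2 : ((μ i : ℕ) : ℝ) ≤ ((μ' i : ℕ) : ℝ) := by exact_mod_cast hle i
      exact mul_le_mul_of_nonneg_left h2 h1
    have hle1 : S.card ≤ 1 := by
      refine Finset.card_le_one.mpr fun μ hμ μ' hμ' => ?_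
      by_contra hne
      obtain ⟨hGμ0, c, hc, hmin⟩ := hS μ hμ
      obtain ⟨hGμ1, c', hc', hmin1⟩ := hS μ' hμ'
      have h1 := hmin μ' (Ne.symm hne) hGμ1
      have h2 := hmin1 μ hne hGμ0
      rcases hcmp μ μ' with hle | hle
      · exact absurd (hmono c' hc' μ μ' hle) (not_le.mpr h2)
      · exact absurd (hmono c hc μ' μ hle) (not_le.mpr h1)
    exact hle1.trans hRHS
  · have hbound := hE m s hs u v hut hvt (S.image π) (by
      intro n hn
      obtain ⟨μ, hμ, rfl⟩ := Finset.mem_image.mp (Finset.mem_coe.mp hn)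
      exact hmaps μ hμ)
    rwa [Finset.card_image_of_injOn hinj] at hbound

end Summit.ValiantsHypothesis.ValiantsHypothesis.Theorems.NewtonUnitEquations.TwoProducts.FormalLogLinearisation

end
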